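import Summits.BirchSwinnertonDyer.BirchSwinnertonDyer.Theorems.UniversalToricDescentTameQuotientEvaluation
import Literature.NumberTheory.GaloisRepresentations.FrobeniusQuotientHOne
import Mathlib.NumberTheory.Padics.PadicVal.Basic
import HarnessLib

/-!
# Route UniversalToricDescent — `H¹(G, A) ≅ (A^N)_{τ}`, surjectivity: every `N`-invariant is a value at `τ`;
# `#H¹(G, B) = #B^G` for finite `B`; `H¹(G, A)` is `p`-divisible for divisible `A`

Lead prover bsd-wall-utd-p1 g10 (`--supports stmt-BirchSwinnertonDyer-20399`; part 2 of the general form of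
the Greenberg–Vatsal Prop. (2.4) inertia computation; part 1 = `UniversalToricDescentTameQuotientEvaluation`).
Same setting (`G` profinite, `N ⊴ G` closed pro-prime-to-`p`, `G = ⋃ₖ τᵏ N U`, `A` discrete `p`-primary,
`C = A^N`), plus: the layers `A[p^k]` are finite and `G/N` is "infinitely `p`-divisible"
(`∀ e, ∃ U, pᵉ ∣ [G : N U]`; for `I_F` this is the `ℤ_p(1)`-quotient).

* `exists_vanishing_apply_eq` — every `c ∈ C` is the value at `τ` of a cocycle vanishing on `N` (the geometric
  cocycle `σ ↦ Σ_{j<idx σ} τʲ c` of a deep enough cyclic level `G/(N U)`, `geomCocycle`); with part 1: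
  `H¹(G, A) ≅ C/(τ − 1)C`.
* `exists_nsmul_eq_of_divisible` — for `p`-divisible `A`: **`H¹(G, A)` is `p`-divisible** (the `μ = 0` /
  cofreeness half of GV (2.4) on the inertia side).
* `natCard_continuousCohomology_one_eq_natCard_invariants` — for FINITE `B`: **`#H¹(G, B) = #B^G`**
  (`#C/(τ−1)C = #C^{τ} = #B^G`), the classical equality behind the tree's inequality
  `natCard_continuousCohomology_one_absInertia_le_natCard_invariants`.

THEOREMS ONLY; no definition, no named fact, no `sorry`. BSD is not advanced by this file.
References: [GreenbergVatsal2000] §2, proof of Prop. (2.4) (arXiv p. 22); [SerreLocalFields1979] Ch. XIII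
§1 Prop. 1; [NeukirchSchmidtWingberg2008] (1.7.1); [MilneADT2006] I §2 Lemma 2.9.
-/

set_option autoImplicit false
-- `…BirchSwinnertonDyer.BirchSwinnertonDyer.Theorems…` is the problem's mandated namespace (D-0017).
set_option linter.dupNamespace false

noncomputable section

open scoped Classical

namespace Summit.BirchSwinnertonDyer.BirchSwinnertonDyer.Theorems.UniversalToricDescentTameQuotientSurjective

open Literature.NumberTheory.GaloisRepresentations ContinuousCohomology Topology Function
  Summit.BirchSwinnertonDyer.BirchSwinnertonDyer.Theorems.UniversalToricDescentProPrimeToP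
  Summit.BirchSwinnertonDyer.BirchSwinnertonDyer.Theorems.UniversalToricDescentTameQuotientVanishing
  Summit.BirchSwinnertonDyer.BirchSwinnertonDyer.Theorems.UniversalToricDescentTameQuotientEvaluation

variable {G : Type} [Group G] [TopologicalSpace G] [IsTopologicalGroup G] [CompactSpace G]
  [TotallyDisconnectedSpace G]
variable {M : Type} [AddCommGroup M] [TopologicalSpace M] [DiscreteTopology M]
variable (ρ : ContinuousRep G ℤ M) {p : ℕ}

/-! ### §1 Surjectivity: every `N`-invariant is a value at `τ` -/

omit [TotallyDisconnectedSpace G] in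
/-- **Every `c ∈ A^N` is the value at `τ` of a continuous crossed homomorphism vanishing on `N`**, when the
layers `A[p^k]` are finite and `G/N` is infinitely `p`-divisible (`hinf`). The cocycle is the geometric
cocycle `σ ↦ Σ_{j<idx σ} τʲ c` of the cyclic quotient `G/(N U)` at a level `U` deep enough that the norm
`Σ_{j<[G:NU]} τʲ c` vanishes. [cite: SerreLocalFields1979, Ch. XIII §1 Prop. 1] [cite: NeukirchSchmidtWingberg2008, (1.7.1)] -/
theorem exists_vanishing_apply_eq (hp : p.Prime) (hM : ∀ m : M, ∃ k : ℕ, p ^ k • m = 0)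
    (hfin : ∀ k : ℕ, Set.Finite {m : M | p ^ k • m = 0})
    (N : Subgroup G) [N.Normal] (τ : G)
    (hgen : ∀ U : Subgroup G, U.Normal → IsOpen (U : Set G) →
      ∀ σ : G, ∃ k : ℕ, ∃ n ∈ N, ∃ u ∈ U, σ = τ ^ k * n * u)
    (hinf : ∀ e : ℕ, ∃ U : Subgroup G, U.Normal ∧ IsOpen (U : Set G) ∧ p ^ e ∣ (N ⊔ U).index)
    (c : M) (hc : ∀ n ∈ N, ρ n c = c) :
    ∃ φ : contOneCocycles ρ.toTopRep, (∀ n ∈ N, φ.1 n = 0) ∧ φ.1 τ = c := by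
  haveI : Fact p.Prime := ⟨hp⟩
  obtain ⟨k, hk⟩ := hM c
  have hconjN : ∀ (g : G) (n : G), n ∈ N → g⁻¹ * n * g ∈ N := fun g n hn ↦ by
    have := ‹N.Normal›.conj_mem n hn g⁻¹
    rwa [inv_inv] at this
  -- the finite `G`-submodule `F = A[p^k] ∩ A^N`
  let F : Submodule ℤ M :=
    { carrier := {m | p ^ k • m = 0 ∧ ∀ n ∈ N, ρ n m = m}
      zero_mem' := ⟨smul_zero _, fun n _ ↦ map_zero _⟩
      add_mem' := fun {a b} ha hb ↦ ⟨by rw [smul_add, ha.1, hb.1, add_zero],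
        fun n hn ↦ by rw [map_add, ha.2 n hn, hb.2 n hn]⟩
      smul_mem' := fun r {a} ha ↦ ⟨by rw [smul_comm, ha.1, smul_zero],
        fun n hn ↦ by rw [map_zsmul, ha.2 n hn]⟩ }
  have hF : ∀ g : G, F ≤ F.comap (ρ g) := fun g m hm ↦ by
    rw [Submodule.mem_comap]
    refine ⟨by rw [← map_nsmul, hm.1, map_zero], fun n hn ↦ ?_⟩
    rw [← Module.End.mul_apply, ← map_mul, show n * g = g * (g⁻¹ * n * g) by group, map_mul,
      Module.End.mul_apply, hm.2 _ (hconjN g n hn)]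
  haveI : Finite F := ((hfin k).subset fun m (hm : m ∈ F) ↦ hm.1).to_subtype
  let ρF : ContinuousRep G ℤ F := ρ.subrepresentation F hF
  let X : TopRep ℤ G := ρF.toTopRep
  have hXρ : ∀ (g : G) (x : F), ((X.ρ g x : F) : M) = ρ g x := fun _ _ ↦ rfl
  let b₀ : X := (⟨c, hk, hc⟩ : F)
  have hpkF : ∀ y : F, p ^ k • y = 0 := fun y ↦
    Subtype.ext (by rw [AddSubmonoidClass.coe_nsmul, y.2.1, ZeroMemClass.coe_zero])
  -- the open normal subgroup `U₁` fixing the finite layer `A[p^k]`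
  let L : Set M := {m | p ^ k • m = 0}
  have hL : L.Finite := hfin k
  let U₁ : Subgroup G :=
    { carrier := {g | ∀ m ∈ L, ρ g m = m}
      one_mem' := fun m _ ↦ by simp
      mul_mem' := fun {g h} hg hh m hm ↦ by
        simp only [Set.mem_setOf_eq] at hg hh ⊢
        rw [map_mul, Module.End.mul_apply, hh m hm, hg m hm]
      inv_mem' := fun {g} hg m hm ↦ by
        simp only [Set.mem_setOf_eq] at hg ⊢
        have h := congrArg (ρ g⁻¹) (hg m hm)
        rw [← Module.End.mul_apply, ← map_mul, inv_mul_cancel, map_one, Module.End.one_apply] at h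
        exact h.symm }
  have hU₁mem : ∀ g : G, g ∈ U₁ ↔ ∀ m ∈ L, ρ g m = m := fun _ ↦ Iff.rfl
  haveI hU₁n : U₁.Normal := ⟨fun u hu g ↦ (hU₁mem _).mpr fun m hm ↦ by
    have hm' : ρ g⁻¹ m ∈ L := by
      show p ^ k • ρ g⁻¹ m = 0
      rw [← map_nsmul, (hm : p ^ k • m = 0), map_zero]
    rw [map_mul, map_mul, Module.End.mul_apply, Module.End.mul_apply, (hU₁mem u).mp hu _ hm',
      ← Module.End.mul_apply, ← map_mul, mul_inv_cancel, map_one, Module.End.one_apply]⟩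
  have hU₁open : IsOpen (U₁ : Set G) := by
    have : (U₁ : Set G) = ⋂ m ∈ L, {g : G | ρ g m = m} := by
      ext g
      simp only [SetLike.mem_coe, hU₁mem, Set.mem_iInter₂, Set.mem_setOf_eq]
    rw [this]
    exact hL.isOpen_biInter fun m _ ↦
      (isOpen_discrete ({m} : Set M)).preimage (ρ.continuous_apply_left m)
  -- the first level `H₁ = N U₁` and the order `m₁` of `τ̄` there
  let H₁ : Subgroup G := N ⊔ U₁
  haveI hH₁n : H₁.Normal := Subgroup.sup_normal N U₁
  have hH₁open : IsOpen (H₁ : Set G) := Subgroup.isOpen_mono le_sup_right hU₁open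
  haveI : Finite (G ⧸ H₁) := Subgroup.quotient_finite_of_isOpen H₁ hH₁open
  set m₁ : ℕ := orderOf (QuotientGroup.mk τ : G ⧸ H₁) with hm₁
  have hm₁pos : 0 < m₁ := orderOf_pos _
  -- `H₁` acts trivially on `F`, hence so does `τ^{m₁}`
  have hH₁F : ∀ h ∈ H₁, ∀ x : F, X.ρ h x = x := by
    intro h hh x
    have hh' : h ∈ ((N ⊔ U₁ : Subgroup G) : Set G) := hh
    rw [Subgroup.normal_mul] at hh'
    obtain ⟨n, hn, u, hu, rfl⟩ := Set.mem_mul.mp hh'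
    apply Subtype.ext
    rw [hXρ, map_mul, Module.End.mul_apply, (hU₁mem u).mp hu _ x.2.1, x.2.2 n hn]
  have hτm₁ : ∀ x : F, X.ρ (τ ^ m₁) x = x := fun x ↦ by
    refine hH₁F _ ?_ x
    rw [← QuotientGroup.eq_one_iff, QuotientGroup.mk_pow, hm₁, pow_orderOf_eq_one]
  -- a deeper level `H = N (U₁ ∩ U')` with `p^(k + m₁) ∣ [G : N U']`
  obtain ⟨U', hU'n, hU'open, hU'dvd⟩ := hinf (k + m₁)
  haveI := hU'n
  let U : Subgroup G := U₁ ⊓ U'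
  haveI hUn : U.Normal := inferInstance
  have hUopen : IsOpen (U : Set G) := hU₁open.inter hU'open
  let H : Subgroup G := N ⊔ U
  haveI hHn : H.Normal := Subgroup.sup_normal N U
  have hHopen : IsOpen (H : Set G) := Subgroup.isOpen_mono le_sup_right hUopen
  haveI : Finite (G ⧸ H) := Subgroup.quotient_finite_of_isOpen H hHopen
  have hHH₁ : H ≤ H₁ := sup_le_sup_left inf_le_left N
  have hHU' : H ≤ N ⊔ U' := sup_le_sup_left inf_le_right N
  have hHF : ∀ h ∈ H, ∀ x : F, X.ρ h x = x := fun h hh x ↦ hH₁F h (hHH₁ hh) x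
  -- `G/H = ⟨τ̄⟩`
  have hgenH : ∀ q : G ⧸ H, ∃ i : ℕ, q = (QuotientGroup.mk τ : G ⧸ H) ^ i := by
    intro q
    induction q using QuotientGroup.induction_on with
    | H σ =>
      obtain ⟨i, n, hn, u, hu, rfl⟩ := hgen U hUn hUopen σ
      refine ⟨i, ?_⟩
      rw [← QuotientGroup.mk_pow, mul_assoc, QuotientGroup.mk_mul,
        (QuotientGroup.eq_one_iff (n * u)).mpr (H.mul_mem (Subgroup.mem_sup_left hn)
          (Subgroup.mem_sup_right hu)), mul_one]
  -- the order `m` of `τ̄` in `G/H`: `m₁ ∣ m` and `p^(k + m₁) ∣ m`, hence `p^k ∣ m / m₁`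
  set m : ℕ := orderOf (QuotientGroup.mk τ : G ⧸ H) with hmdef
  have hm0 : m ≠ 0 := (orderOf_pos _).ne'
  have hm_card : m = H.index := by
    rw [hmdef, orderOf_eq_card_of_forall_mem_zpowers, Subgroup.index]
    intro q
    obtain ⟨i, hi⟩ := hgenH q
    exact hi ▸ Subgroup.npow_mem_zpowers _ i
  have hm₁m : m₁ ∣ m := by
    refine orderOf_dvd_of_pow_eq_one ?_
    rw [← QuotientGroup.mk_pow, QuotientGroup.eq_one_iff]
    apply hHH₁
    rw [← QuotientGroup.eq_one_iff, QuotientGroup.mk_pow, hmdef, pow_orderOf_eq_one]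
  have hpm : p ^ (k + m₁) ∣ m := by
    rw [hm_card]
    exact hU'dvd.trans (Subgroup.index_dvd_of_le hHU')
  obtain ⟨q, hq⟩ := hm₁m
  have hq0 : q ≠ 0 := fun h ↦ hm0 (by rw [hq, h, mul_zero])
  have hpkq : p ^ k ∣ q := by
    have hv_m : k + m₁ ≤ padicValNat p m := (padicValNat_dvd_iff_le hm0).mp hpm
    have hv_m₁ : padicValNat p m₁ ≤ m₁ := by
      have h1 : p ^ padicValNat p m₁ ∣ m₁ := pow_padicValNat_dvd
      exact (Nat.lt_pow_self hp.one_lt).le.trans (Nat.le_of_dvd hm₁pos h1)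
    have hmul : padicValNat p m = padicValNat p m₁ + padicValNat p q := by
      rw [hq]; exact padicValNat.mul hm₁pos.ne' hq0
    exact (padicValNat_dvd_iff_le hq0).mpr (by omega)
  -- the norm vanishes: `Σ_{j<m} τʲ c = q • Σ_{j<m₁} τʲ c = 0`
  have hN : geomSum τ b₀ (orderOf (QuotientGroup.mk τ : G ⧸ H)) = 0 := by
    rw [← hmdef, hq, geomSum_mul_eq_smul τ b₀ hτm₁ q]
    obtain ⟨r, hr⟩ := hpkq
    rw [hr, mul_comm, ← smul_smul, hpkF, smul_zero]
  -- the geometric cocycle with values in `F`, pushed to `A`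
  let φF := geomCocycle τ b₀ H hgenH hHopen hHF hN
  have hφF : ∀ σ : G, φF.1 σ = geomSum τ b₀ (idxQ H τ hgenH (σ : G ⧸ H)) := fun σ ↦
    geomCocycle_apply τ b₀ H hgenH hHopen hHF hN σ
  have hφFτ : φF.1 τ = b₀ := geomCocycle_apply_self τ b₀ H hgenH hHopen hHF hN
  let φ : contOneCocycles ρ.toTopRep :=
    ⟨⟨fun g ↦ ((φF.1 g : F) : M), continuous_subtype_val.comp φF.1.continuous⟩, fun g h ↦ by
      show ((φF.1 (g * h) : F) : M) = ((φF.1 g : F) : M) + ρ g ((φF.1 h : F) : M)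
      rw [φF.2 g h]
      rfl⟩
  refine ⟨φ, fun n hn ↦ ?_, ?_⟩
  · show ((φF.1 n : F) : M) = 0
    have h1 : ((n : G) : G ⧸ H) = 1 := (QuotientGroup.eq_one_iff n).mpr (Subgroup.mem_sup_left hn)
    have hidx : (QuotientGroup.mk τ : G ⧸ H) ^ idxQ H τ hgenH ((n : G) : G ⧸ H) = 1 :=
      (idxQ_spec H τ hgenH _).symm.trans h1
    have hmod : idxQ H τ hgenH ((n : G) : G ⧸ H) ≡ 0 [MOD orderOf (QuotientGroup.mk τ : G ⧸ H)] :=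
      Nat.modEq_zero_iff_dvd.mpr (orderOf_dvd_of_pow_eq_one hidx)
    rw [hφF, geomSum_eq_of_modEq τ b₀ hN hmod, geomSum_zero]
    rfl
  · show ((φF.1 τ : F) : M) = c
    rw [hφFτ]

/-! ### §2 Consequences: divisibility of `H¹(G, A)`; `#H¹(G, B) = #B^G` for finite `B` -/

/-- **`H¹(G, A)` is `p`-divisible** for a `p`-divisible `p`-primary `A` with finite layers (and `G = cl⟨N, τ⟩`,
`N` pro-prime-to-`p`, `G/N` infinitely `p`-divisible): a class is `[φ]` with `φ|_N = 0`, `φ(τ) = c = p c'`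
with `c' ∈ A^N`, and `c'` is a value at `τ` (§4). This is the `μ = 0` / cofreeness half of
Greenberg–Vatsal's Prop. (2.4) on the inertia side. [cite: GreenbergVatsal2000, §2, proof of Prop. (2.4) (arXiv p. 22)] -/
theorem exists_nsmul_eq_of_divisible (hp : p.Prime) (hM : ∀ m : M, ∃ k : ℕ, p ^ k • m = 0)
    (hdiv : ∀ m : M, ∃ m' : M, p • m' = m) (hfin : ∀ k : ℕ, Set.Finite {m : M | p ^ k • m = 0})
    (N : Subgroup G) [N.Normal] (hNc : IsClosed (N : Set G))
    (hcopN : ∀ U : Subgroup N, U.Normal → IsOpen (U : Set N) → U.index.Coprime p) (τ : G)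
    (hgen : ∀ U : Subgroup G, U.Normal → IsOpen (U : Set G) →
      ∀ σ : G, ∃ k : ℕ, ∃ n ∈ N, ∃ u ∈ U, σ = τ ^ k * n * u)
    (hinf : ∀ e : ℕ, ∃ U : Subgroup G, U.Normal ∧ IsOpen (U : Set G) ∧ p ^ e ∣ (N ⊔ U).index)
    (x : continuousCohomology 1 ρ.toTopRep) : ∃ y : continuousCohomology 1 ρ.toTopRep, p • y = x := by
  obtain ⟨φ, rfl⟩ := oneCocycleClass_surjective _ x
  obtain ⟨φ', hφ', hφ'N⟩ := exists_oneCocycleClass_eq_vanishing ρ hM N hNc hcopN φ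
  have hcN := apply_mem_invariants_of_vanishing ρ N φ' hφ'N τ
  obtain ⟨c', hc'N, hc'⟩ := exists_invariant_nsmul_eq ρ hdiv N hNc hcopN (φ'.1 τ) hcN
  obtain ⟨ψ, hψN, hψτ⟩ := exists_vanishing_apply_eq ρ hp hM hfin N τ hgen hinf c' hc'N
  refine ⟨oneCocycleClass _ ψ, ?_⟩
  have hsmul : p • oneCocycleClass ρ.toTopRep ψ = oneCocycleClass ρ.toTopRep (p • ψ) := by
    rw [← oneCocycleClassₗ_apply, ← oneCocycleClassₗ_apply, map_nsmul]
  rw [← hφ', hsmul, eq_comm,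
    oneCocycleClass_eq_iff_of_vanishing ρ N τ hgen φ' (p • ψ) hφ'N (fun n hn ↦ by
      show p • ψ.1 n = 0
      rw [hψN n hn, smul_zero])]
  refine ⟨0, fun n _ ↦ map_zero _, ?_⟩
  show φ'.1 τ - p • ψ.1 τ = ρ τ 0 - 0
  rw [hψτ, hc', sub_self, map_zero, sub_zero]

/-- **`#H¹(G, B) = #B^G` for a FINITE `p`-primary `B`** (`G = cl⟨N, τ⟩`, `N ⊴ G` closed pro-prime-to-`p`,
`G/N` infinitely `p`-divisible): `H¹(G, B) ≅ C/(τ − 1)C` with `C = B^N` (§§2–4), and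
`#C/(τ − 1)C = #ker(τ − 1 | C) = #B^G`. The classical equality behind the tree's inequality
`natCard_continuousCohomology_one_absInertia_le_natCard_invariants`. [cite: SerreLocalFields1979, Ch. XIII §1 Prop. 1]
[cite: MilneADT2006, I §2 Lemma 2.9 and proof of Thm. 2.8] -/
theorem natCard_continuousCohomology_one_eq_natCard_invariants [Finite M] (hp : p.Prime)
    (hM : ∀ m : M, ∃ k : ℕ, p ^ k • m = 0)
    (N : Subgroup G) [N.Normal] (hNc : IsClosed (N : Set G))
    (hcopN : ∀ U : Subgroup N, U.Normal → IsOpen (U : Set N) → U.index.Coprime p) (τ : G)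
    (hgen : ∀ U : Subgroup G, U.Normal → IsOpen (U : Set G) →
      ∀ σ : G, ∃ k : ℕ, ∃ n ∈ N, ∃ u ∈ U, σ = τ ^ k * n * u)
    (hinf : ∀ e : ℕ, ∃ U : Subgroup G, U.Normal ∧ IsOpen (U : Set G) ∧ p ^ e ∣ (N ⊔ U).index) :
    Nat.card (continuousCohomology 1 ρ.toTopRep) = Nat.card {m : M // ∀ g : G, ρ g m = m} := by
  have hfin : ∀ k : ℕ, Set.Finite {m : M | p ^ k • m = 0} := fun _ ↦ Set.toFinite _
  have hconjN : ∀ (g : G) (n : G), n ∈ N → g⁻¹ * n * g ∈ N := fun g n hn ↦ by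
    have := ‹N.Normal›.conj_mem n hn g⁻¹
    rwa [inv_inv] at this
  -- `C = B^N` and `T = τ − 1` on it
  let Cs : AddSubgroup M :=
    { carrier := {m | ∀ n ∈ N, ρ n m = m}
      zero_mem' := fun n _ ↦ map_zero _
      add_mem' := fun {a b} ha hb n hn ↦ by rw [map_add, ha n hn, hb n hn]
      neg_mem' := fun {a} ha n hn ↦ by rw [map_neg, ha n hn] }
  have hτC : ∀ m ∈ Cs, ρ τ m ∈ Cs := fun m hm n hn ↦ by
    rw [← Module.End.mul_apply, ← map_mul, show n * τ = τ * (τ⁻¹ * n * τ) by group, map_mul,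
      Module.End.mul_apply, hm _ (hconjN τ n hn)]
  let T : Cs →+ Cs :=
    { toFun := fun c ↦ ⟨ρ τ c - c, Cs.sub_mem (hτC c c.2) c.2⟩
      map_zero' := Subtype.ext (by simp)
      map_add' := fun a b ↦ Subtype.ext (by
        simp only [AddSubgroup.coe_add, map_add, AddMemClass.mk_add_mk]
        abel) }
  have hT : ∀ c : Cs, ((T c : Cs) : M) = ρ τ c - c := fun _ ↦ rfl
  -- vanishing representatives
  choose rep hrep using oneCocycleClass_surjective ρ.toTopRep
  choose van hvan hvanN using fun x : continuousCohomology 1 ρ.toTopRep ↦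
    exists_oneCocycleClass_eq_vanishing ρ hM N hNc hcopN (rep x)
  have hclass : ∀ x, oneCocycleClass _ (van x) = x := fun x ↦ by rw [hvan, hrep]
  have hmem : ∀ x, (van x).1 τ ∈ Cs := fun x ↦ apply_mem_invariants_of_vanishing ρ N (van x) (hvanN x) τ
  -- the bijection `[φ] ↦ φ(τ) mod (τ − 1)C`
  let Φ : continuousCohomology 1 ρ.toTopRep → Cs ⧸ T.range := fun x ↦
    QuotientAddGroup.mk ⟨(van x).1 τ, hmem x⟩
  have hΦ : Function.Bijective Φ := by
    constructor
    · intro x y hxy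
      obtain ⟨d, hd⟩ := (QuotientAddGroup.eq_iff_sub_mem.mp hxy)
      have hd' : (van x).1 τ - (van y).1 τ = ρ τ d - d := by
        have := congrArg Subtype.val hd
        rw [hT, AddSubgroupClass.coe_sub] at this
        exact this.symm
      rw [← hclass x, ← hclass y]
      exact (oneCocycleClass_eq_iff_of_vanishing ρ N τ hgen (van x) (van y) (hvanN x) (hvanN y)).mpr
        ⟨d, d.2, hd'⟩
    · intro q
      induction q using QuotientAddGroup.induction_on with
      | H c =>
        obtain ⟨φ, hφN, hφτ⟩ := exists_vanishing_apply_eq ρ hp hM hfin N τ hgen hinf c c.2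
        refine ⟨oneCocycleClass _ φ, ?_⟩
        have heq : oneCocycleClass _ (van (oneCocycleClass _ φ)) = oneCocycleClass _ φ := hclass _
        obtain ⟨d, hdN, hd⟩ := (oneCocycleClass_eq_iff_of_vanishing ρ N τ hgen _ φ (hvanN _) hφN).mp heq
        show QuotientAddGroup.mk _ = QuotientAddGroup.mk c
        rw [QuotientAddGroup.eq_iff_sub_mem]
        refine ⟨⟨d, hdN⟩, Subtype.ext ?_⟩
        rw [hT, AddSubgroup.coe_sub]
        show ρ τ d - d = (van (oneCocycleClass _ φ)).1 τ - c
        rw [← hd, hφτ]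
  rw [Nat.card_congr (Equiv.ofBijective Φ hΦ)]
  -- `#C/(τ − 1)C = #ker T`
  haveI : Finite Cs := inferInstance
  have h1 : Nat.card (Cs ⧸ T.range) * Nat.card T.range = Nat.card Cs :=
    (AddSubgroup.card_eq_card_quotient_mul_card_addSubgroup T.range).symm
  have h2 : Nat.card T.range * Nat.card T.ker = Nat.card Cs := by
    rw [← Nat.card_congr (QuotientAddGroup.quotientKerEquivRange T).toEquiv,
      ← AddSubgroup.card_eq_card_quotient_mul_card_addSubgroup]
  have hpos : 0 < Nat.card T.range := Nat.card_pos
  have h3 : Nat.card (Cs ⧸ T.range) = Nat.card T.ker := by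
    have : Nat.card (Cs ⧸ T.range) * Nat.card T.range = Nat.card T.ker * Nat.card T.range := by
      rw [h1, mul_comm, h2]
    exact Nat.eq_of_mul_eq_mul_right hpos this
  rw [h3]
  -- `ker T = B^G`
  refine Nat.card_congr ?_
  refine
    { toFun := fun x ↦ ⟨((x : Cs) : M), fun g ↦ ?_⟩
      invFun := fun m ↦ ⟨⟨m.1, fun n _ ↦ m.2 n⟩, ?_⟩
      left_inv := fun x ↦ Subtype.ext (Subtype.ext rfl)
      right_inv := fun m ↦ Subtype.ext rfl }
  · -- an element of `C` fixed by `τ` is fixed by `G`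
    have hx : ρ τ ((x : Cs) : M) = (x : Cs) := by
      have := congrArg Subtype.val ((AddMonoidHom.mem_ker).mp x.2)
      exact sub_eq_zero.mp this
    let Z : Subgroup G :=
      { carrier := {g | ρ g ((x : Cs) : M) = (x : Cs)}
        one_mem' := by simp
        mul_mem' := fun {g h} hg hh ↦ by
          simp only [Set.mem_setOf_eq] at hg hh ⊢
          rw [map_mul, Module.End.mul_apply, hh, hg]
        inv_mem' := fun {g} hg ↦ by
          simp only [Set.mem_setOf_eq] at hg ⊢
          have h := congrArg (ρ g⁻¹) hg
          rw [← Module.End.mul_apply, ← map_mul, inv_mul_cancel, map_one, Module.End.one_apply] at h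
          exact h.symm }
    have hZ : IsOpen (Z : Set G) :=
      (isOpen_discrete ({((x : Cs) : M)} : Set M)).preimage (ρ.continuous_apply_left _)
    exact forall_mem_of_isOpen N τ hgen Z hZ (fun n hn ↦ (x : Cs).2 n hn) hx g
  · rw [AddMonoidHom.mem_ker]
    exact Subtype.ext (by rw [hT]; exact sub_eq_zero.mpr (m.2 τ))

end Summit.BirchSwinnertonDyer.BirchSwinnertonDyer.Theorems.UniversalToricDescentTameQuotientSurjective

end
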